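import Summits.CriticalPhenomena.PercolationContinuityZ3.Theorems.PercNearOneGluingNoHeavyLowerTailThreePointProductFormFibreTerminalNetworkS1J
import Summits.CriticalPhenomena.PercolationContinuityZ3.Theorems.PercNearOneGluingNoHeavyLowerTailThreePointProductFormFibreFlatPreimage
import HarnessLib

/-!
# The product form in the fibre language: the mirror inequality (S1J′) `(#bad + w′)² ≤ #P2·#J` transfers through terminal networks
# (Sahi programme, prover prim-sahi-p2 gen 56)

Support file (`--supports stmt-CriticalPhenomena-4575`, helper); completes `…FibreTerminalNetworkS1J` (same gen): with it, the SYSTEM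
`𝒮 = {(P), (S1J), (S1J′)}` of a graph `H` with a terminal network hung at `s` follows from `𝒮` of the far side — in particular single pendant
terminal labels are reducible for `𝒮`.  Standard axioms, no sorries, no named facts, no definitions.  Memo
`run/shared/lean/prim/prim-sahi/FROM-prim-sahi-p2-gen56-REFINED-PRODUCT-FORM.md` §10 (iii); PROOF-E3 (66i).
* `w2_iff_network` [this work] — pointwise `w′(H) = (Cn-part ∩ W2) ⊔ (Vn-part ∩ Jt)`: `a ↔ c, a ↮ s, s ↔ c in ♭z` iff (`u ↔ s` and the far `w′`-event
  `a ↔ c, a ↮ u, u ↔ c in ♭z`) or (`u ↮ s, u ↔ s in ♭_u z` and the far `j`-event `a ↔ u, a ↔ c, u ↔ c in ♭z`).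
* `network_arith_S1Jc` [this work] — `x² ≤ Q2·J`, `x + y = J`, `Vn ≤ Cn`, `Vn ≤ Dn` ⟹ `(Cn·x + Vn·y)² ≤ Cn·J·((Cn+Dn)·Q2 + Dn·J)`.
* **`S1Jc_of_terminalNetwork`** [this work] — if `(#bad′ + w′₂)² ≤ #P2′·#J′` on the far side `(u,a,c)` then `(#bad + w′)² ≤ #P2·#J` on `H` for `(s,a,c)`;
  uses `#bad = Cn·bad′ + Vn·w′`, `w′(H) = Cn·w′₂ + Vn·j′`, `#P2 = (Cn+Dn)·P2′ + Dn·J′`, `#J = Cn·J′`, the identity `bad′ + w′ + w′₂ + j′ = J′`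
  (`…FlatPreimage`) and `Vn ≤ min(Cn, Dn)` (`…FibreFlat`).
[folklore] (product counting across a cut vertex); [cite: Gladkov2024, Conjecture 10.1 (p. 18), arXiv:2408.08457] for CONJECTURE (P) served.
-/

namespace Summit.CriticalPhenomena.PercolationContinuityZ3.Theorems.ProductFormFibre

open Finset Literature.Probability.Percolation
open Summit.CriticalPhenomena.PercolationContinuityZ3.Theorems.ThreePointCPIClusterSwap (clusterFlip)

variable {V α : Type*}

section PointwiseS1Jc

variable (ends : α → Sym2 V) (u : V) (W : Set V) [DecidableEq V]

/-- **`w′(H)` pointwise**: `a ↔ c ∧ a ↮ s ∧ (s ↔ c in ♭z)` iff (`u ↔ s` ∧ (`a ↔ c ∧ a ↮ u`) ∧ `u ↔ c in ♭z`) or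
((`u ↮ s` ∧ `u ↔ s in ♭_u z`) ∧ (`a ↔ u ∧ a ↔ c`) ∧ `u ↔ c in ♭z`). [this work] -/
theorem w2_iff_network
    (hsep : ∀ l : α, (∀ v ∈ ends l, v ∈ W ∨ v = u) ∨ (∀ v ∈ ends l, v ∉ W ∨ v = u)) (huW : u ∉ W)
    {a s c : V} (hs : s ∈ W) (haW : a ∉ W) (hau : a ≠ u) (hcW : c ∉ W) (z : α → Bool) :
    (((openGraph (labelledOpen ends z)).Reachable a c ∧ ¬ (openGraph (labelledOpen ends z)).Reachable a s) ∧
      (openGraph (labelledOpen ends (clusterFlip ends a fun x => !z x))).Reachable s c) ↔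
    (((openGraph (labelledOpen ends z)).Reachable u s ∧
        (((openGraph (labelledOpen ends z)).Reachable a c ∧ ¬ (openGraph (labelledOpen ends z)).Reachable a u) ∧
          (openGraph (labelledOpen ends (clusterFlip ends a fun x => !z x))).Reachable u c)) ∨
      ((¬ (openGraph (labelledOpen ends z)).Reachable u s ∧
          (openGraph (labelledOpen ends (clusterFlip ends u fun x => !z x))).Reachable u s) ∧
        (((openGraph (labelledOpen ends z)).Reachable a u ∧ (openGraph (labelledOpen ends z)).Reachable a c) ∧
          (openGraph (labelledOpen ends (clusterFlip ends a fun x => !z x))).Reachable u c))) := by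
  have cut_a := reachable_cut_iff ends u W hsep huW z hs haW
  have cut_c' := reachable_cut_iff ends u W hsep huW (clusterFlip ends a fun x => !z x) hs hcW
  constructor
  · rintro ⟨⟨hac, has⟩, hf⟩
    obtain ⟨hfsu, hfuc⟩ := cut_c'.1 hf
    by_cases hau' : (openGraph (labelledOpen ends z)).Reachable a u
    · right
      have hus : ¬ (openGraph (labelledOpen ends z)).Reachable u s := fun h => has (hau'.trans h)
      have hflat := flat_eq_flat_of_reachable ends z hau'
      refine ⟨⟨hus, ?_⟩, ⟨hau', hac⟩, hfuc⟩
      rw [← hflat]; exact hfsu.symm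
    · left
      have hagree : ∀ l, (∀ v ∈ ends l, v ∈ W ∨ v = u) → ¬ (ends l).IsDiag →
          clusterFlip ends a (fun x => !z x) l = z l :=
        fun l hl _ => flat_apply_eq_self_inside_of_not_reachable ends u W hsep huW haW hau z hau' hl
      have hus : (openGraph (labelledOpen ends z)).Reachable u s :=
        (reachable_iff_of_agree_inside ends u W hsep huW hagree (Or.inl hs)).1 hfsu.symm
      exact ⟨hus, ⟨hac, hau'⟩, hfuc⟩
  · rintro (⟨hus, ⟨hac, hau'⟩, hfuc⟩ | ⟨⟨hus, hvs⟩, ⟨hau', hac⟩, hfuc⟩)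
    · have hagree : ∀ l, (∀ v ∈ ends l, v ∈ W ∨ v = u) → ¬ (ends l).IsDiag →
          z l = clusterFlip ends a (fun x => !z x) l :=
        fun l hl _ => (flat_apply_eq_self_inside_of_not_reachable ends u W hsep huW haW hau z hau' hl).symm
      have hfsu : (openGraph (labelledOpen ends (clusterFlip ends a fun x => !z x))).Reachable u s :=
        (reachable_iff_of_agree_inside ends u W hsep huW hagree (Or.inl hs)).1 hus
      refine ⟨⟨hac, fun has => hau' (cut_a.1 has.symm).2.symm⟩, hfsu.symm.trans hfuc⟩
    · have hflat := flat_eq_flat_of_reachable ends z hau'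
      have hfsu : (openGraph (labelledOpen ends (clusterFlip ends a fun x => !z x))).Reachable s u := by
        rw [hflat]; exact hvs.symm
      exact ⟨⟨hac, fun has => hus (hau'.symm.trans has)⟩, hfsu.trans hfuc⟩

end PointwiseS1Jc

/-- **The arithmetic of the (S1J′) transfer.** [this work] -/
theorem network_arith_S1Jc (x y Q2 J Cn Dn Vn : ℕ) (h : x ^ 2 ≤ Q2 * J) (hxy : x + y = J) (hVC : Vn ≤ Cn) (hVD : Vn ≤ Dn) :
    (Cn * x + Vn * y) ^ 2 ≤ Cn * J * ((Cn + Dn) * Q2 + Dn * J) := by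
  have h1 : (Cn * x + Vn * y) ^ 2 ≤ Cn * Cn * (x * x) + 2 * Cn * Dn * (x * y) + Cn * Dn * (y * y) := by
    have e : (Cn * x + Vn * y) ^ 2 = Cn * Cn * (x * x) + 2 * Cn * Vn * (x * y) + Vn * Vn * (y * y) := by ring
    rw [e]
    have t2 : 2 * Cn * Vn * (x * y) ≤ 2 * Cn * Dn * (x * y) :=
      Nat.mul_le_mul_right _ (Nat.mul_le_mul_left _ hVD)
    have t3 : Vn * Vn * (y * y) ≤ Cn * Dn * (y * y) := Nat.mul_le_mul_right _ (Nat.mul_le_mul hVC hVD)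
    omega
  have h2 : Cn * Cn * (x * x) + 2 * Cn * Dn * (x * y) + Cn * Dn * (y * y) ≤ Cn * J * ((Cn + Dn) * Q2 + Dn * J) := by
    subst hxy
    have hx2 : x * x ≤ Q2 * (x + y) := by rw [← sq]; exact h
    have tA : Cn * Cn * (x * x) ≤ Cn * Cn * (Q2 * (x + y)) := Nat.mul_le_mul_left _ hx2
    have tB : Cn * Dn * (x * x) ≤ Cn * Dn * (Q2 * (x + y)) := Nat.mul_le_mul_left _ hx2
    have e : Cn * (x + y) * ((Cn + Dn) * Q2 + Dn * (x + y)) =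
        Cn * Cn * (Q2 * (x + y)) + Cn * Dn * (Q2 * (x + y)) + (Cn * Dn * (x * x) + 2 * Cn * Dn * (x * y) + Cn * Dn * (y * y)) := by ring
    rw [e]
    omega
  exact le_trans h1 h2

section CountsS1Jc

variable [Fintype α] [DecidableEq α] [DecidableEq V]

open Classical in
/-- **(S1J′) TRANSFERS THROUGH A TERMINAL NETWORK.**  In the setting of R3 (`u ∉ W` separates `W ∋ s` from the rest, `a, c ∉ W`, `a ≠ u`, `c ≠ u`):
if the far side satisfies `(S1J′)` for `(u, a, c)` — `(#bad′ + w′₂)² ≤ #P2′ · #J′` — then `(#bad + w′)² ≤ #P2 · #J` for `(s, a, c)`. [this work] -/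
theorem S1Jc_of_terminalNetwork (ends : α → Sym2 V) (u a s c : V) (W : Set V)
    (hsep : ∀ l : α, (∀ v ∈ ends l, v ∈ W ∨ v = u) ∨ (∀ v ∈ ends l, v ∉ W ∨ v = u))
    (huW : u ∉ W) (hs : s ∈ W) (haW : a ∉ W) (hau : a ≠ u) (hcW : c ∉ W) (hcu : c ≠ u)
    (h : ((univ.filter fun z : α → Bool =>
        (¬ (openGraph (labelledOpen ends z)).Reachable a u ∧ ¬ (openGraph (labelledOpen ends z)).Reachable a c ∧
            ¬ (openGraph (labelledOpen ends z)).Reachable u c) ∧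
          (openGraph (labelledOpen ends (clusterFlip ends a fun x => !z x))).Reachable u c).card +
        (univ.filter fun z : α → Bool =>
          ((openGraph (labelledOpen ends z)).Reachable a c ∧ ¬ (openGraph (labelledOpen ends z)).Reachable a u) ∧
            (openGraph (labelledOpen ends (clusterFlip ends a fun x => !z x))).Reachable u c).card) ^ 2 ≤
      (univ.filter fun z : α → Bool =>
        (openGraph (labelledOpen ends z)).Reachable a c ∧ ¬ (openGraph (labelledOpen ends z)).Reachable a u).card *
      (univ.filter fun z : α → Bool =>
        (openGraph (labelledOpen ends z)).Reachable a u ∧ (openGraph (labelledOpen ends z)).Reachable a c).card) :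
    ((univ.filter fun z : α → Bool =>
        (¬ (openGraph (labelledOpen ends z)).Reachable a s ∧ ¬ (openGraph (labelledOpen ends z)).Reachable a c ∧
            ¬ (openGraph (labelledOpen ends z)).Reachable s c) ∧
          (openGraph (labelledOpen ends (clusterFlip ends a fun x => !z x))).Reachable s c).card +
      (univ.filter fun z : α → Bool =>
        ((openGraph (labelledOpen ends z)).Reachable a c ∧ ¬ (openGraph (labelledOpen ends z)).Reachable a s) ∧
          (openGraph (labelledOpen ends (clusterFlip ends a fun x => !z x))).Reachable s c).card) ^ 2 ≤
    (univ.filter fun z : α → Bool =>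
        (openGraph (labelledOpen ends z)).Reachable a c ∧ ¬ (openGraph (labelledOpen ends z)).Reachable a s).card *
    (univ.filter fun z : α → Bool =>
        (openGraph (labelledOpen ends z)).Reachable a s ∧ (openGraph (labelledOpen ends z)).Reachable a c).card := by
  set T : Set V := {v : V | v ∉ W ∧ v ≠ u} with hT
  have hsepT := separates_compl ends u W hsep
  have huT : u ∉ T := fun h' => h'.2 rfl
  have haT : a ∈ T ∨ a = u := Or.inl ⟨haW, hau⟩
  have hcT : c ∈ T ∨ c = u := Or.inl ⟨hcW, hcu⟩
  have huT' : u ∈ T ∨ u = u := Or.inr rfl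
  let ins : α → Prop := fun l => (∀ v ∈ ends l, v ∈ W ∨ v = u) ∧ ¬ (ends l).IsDiag
  have hagW : ∀ z z' : α → Bool, (∀ l, ins l → z l = z' l) →
      ∀ l, (∀ v ∈ ends l, v ∈ W ∨ v = u) → ¬ (ends l).IsDiag → z l = z' l :=
    fun z z' h l hl hd => h l ⟨hl, hd⟩
  have hagT : ∀ z z' : α → Bool, (∀ l, ¬ ins l → z l = z' l) →
      ∀ l, (∀ v ∈ ends l, v ∈ T ∨ v = u) → ¬ (ends l).IsDiag → z l = z' l := by
    intro z z' h l hl hd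
    refine h l fun hins => hd (isDiag_of_forall_eq (a := u) fun v hv => ?_)
    rcases hins.1 v hv with h1 | h1
    · rcases hl v hv with h2 | h2
      · exact absurd h1 h2.1
      · exact h2
    · exact h1
  have hR_in : ∀ z z' : α → Bool, (∀ l, ins l → z l = z' l) →
      ((openGraph (labelledOpen ends z)).Reachable u s ↔ (openGraph (labelledOpen ends z')).Reachable u s) :=
    fun z z' h => reachable_iff_of_agree_inside ends u W hsep huW (hagW z z' h) (Or.inl hs)
  have hV_in : ∀ z z' : α → Bool, (∀ l, ins l → z l = z' l) →
      (¬ (openGraph (labelledOpen ends z)).Reachable u s ∧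
          (openGraph (labelledOpen ends (clusterFlip ends u fun x => !z x))).Reachable u s) →
      (¬ (openGraph (labelledOpen ends z')).Reachable u s ∧
          (openGraph (labelledOpen ends (clusterFlip ends u fun x => !z' x))).Reachable u s) :=
    fun z z' h hz => (virtual_iff_of_agree ends u W hsep huW (hagW z z' h) (Or.inl hs)).1 hz
  have hR_out : ∀ z z' : α → Bool, (∀ l, ¬ ins l → z l = z' l) → ∀ {x y : V}, (x ∈ T ∨ x = u) → (y ∈ T ∨ y = u) →
      ((openGraph (labelledOpen ends z)).Reachable x y ↔ (openGraph (labelledOpen ends z')).Reachable x y) :=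
    fun z z' h x y hx hy => reachable_iff_of_agree_outside ends u W hsep huW (hagT z z' h) hx hy
  have hF_out : ∀ z z' : α → Bool, (∀ l, ¬ ins l → z l = z' l) →
      ((openGraph (labelledOpen ends (clusterFlip ends a fun x => !z x))).Reachable u c ↔
        (openGraph (labelledOpen ends (clusterFlip ends a fun x => !z' x))).Reachable u c) :=
    fun z z' h => reachable_iff_of_agree_outside ends u W hsep huW
      (fun l hl hd => flat_apply_eq_of_agree_outside ends u W hsep huW (hagT z z' h) haT hl hd) huT' hcT
  -- rewrite the sets of `H`
  have ebad := Finset.filter_congr (s := (univ : Finset (α → Bool)))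
    fun z _ => bad_iff_network ends u W hsep huW hs haW hau hcW z
  have ew2 := Finset.filter_congr (s := (univ : Finset (α → Bool)))
    fun z _ => w2_iff_network ends u W hsep huW hs haW hau hcW z
  have eP2 := Finset.filter_congr (s := (univ : Finset (α → Bool)))
    fun z _ => ac_iff_network ends u W hsep huW (c := c) hs haW z
  have eJ := Finset.filter_congr (s := (univ : Finset (α → Bool)))
    fun z _ => joined_iff_network ends u W hsep huW (c := c) hs haW z
  rw [ebad, ew2, eP2, eJ, Finset.filter_or, Finset.filter_or, Finset.filter_or]
  have hdisj1 : Disjoint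
      (univ.filter fun z : α → Bool => (openGraph (labelledOpen ends z)).Reachable u s ∧
        ((¬ (openGraph (labelledOpen ends z)).Reachable a u ∧ ¬ (openGraph (labelledOpen ends z)).Reachable a c ∧
            ¬ (openGraph (labelledOpen ends z)).Reachable u c) ∧
          (openGraph (labelledOpen ends (clusterFlip ends a fun x => !z x))).Reachable u c))
      (univ.filter fun z : α → Bool => (¬ (openGraph (labelledOpen ends z)).Reachable u s ∧
          (openGraph (labelledOpen ends (clusterFlip ends u fun x => !z x))).Reachable u s) ∧
        (((openGraph (labelledOpen ends z)).Reachable a u ∧ ¬ (openGraph (labelledOpen ends z)).Reachable a c) ∧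
          (openGraph (labelledOpen ends (clusterFlip ends a fun x => !z x))).Reachable u c)) := by
    rw [Finset.disjoint_filter]; intro z _ h1 h2; exact h2.1.1 h1.1
  have hdisj2 : Disjoint
      (univ.filter fun z : α → Bool => (openGraph (labelledOpen ends z)).Reachable u s ∧
        (((openGraph (labelledOpen ends z)).Reachable a c ∧ ¬ (openGraph (labelledOpen ends z)).Reachable a u) ∧
          (openGraph (labelledOpen ends (clusterFlip ends a fun x => !z x))).Reachable u c))
      (univ.filter fun z : α → Bool => (¬ (openGraph (labelledOpen ends z)).Reachable u s ∧
          (openGraph (labelledOpen ends (clusterFlip ends u fun x => !z x))).Reachable u s) ∧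
        (((openGraph (labelledOpen ends z)).Reachable a u ∧ (openGraph (labelledOpen ends z)).Reachable a c) ∧
          (openGraph (labelledOpen ends (clusterFlip ends a fun x => !z x))).Reachable u c)) := by
    rw [Finset.disjoint_filter]; intro z _ h1 h2; exact h2.1.1 h1.1
  have hdisj3 : Disjoint
      (univ.filter fun z : α → Bool =>
        (openGraph (labelledOpen ends z)).Reachable a c ∧ ¬ (openGraph (labelledOpen ends z)).Reachable a u)
      (univ.filter fun z : α → Bool => ¬ (openGraph (labelledOpen ends z)).Reachable u s ∧
        ((openGraph (labelledOpen ends z)).Reachable a c ∧ (openGraph (labelledOpen ends z)).Reachable a u)) := by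
    rw [Finset.disjoint_filter]; intro z _ h1 h2; exact h1.2 h2.2.2
  rw [Finset.card_union_of_disjoint hdisj1, Finset.card_union_of_disjoint hdisj2, Finset.card_union_of_disjoint hdisj3]
  -- independence counts
  have hI1 := card_and_mul_card_univ ins
    (fun z => (openGraph (labelledOpen ends z)).Reachable u s)
    (fun z => (¬ (openGraph (labelledOpen ends z)).Reachable a u ∧ ¬ (openGraph (labelledOpen ends z)).Reachable a c ∧
          ¬ (openGraph (labelledOpen ends z)).Reachable u c) ∧
        (openGraph (labelledOpen ends (clusterFlip ends a fun x => !z x))).Reachable u c)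
    (fun z z' h hz => (hR_in z z' h).1 hz)
    (by
      rintro z z' h ⟨⟨e1, e2, e3⟩, e4⟩
      exact ⟨⟨fun h' => e1 ((hR_out z z' h haT huT').2 h'), fun h' => e2 ((hR_out z z' h haT hcT).2 h'),
        fun h' => e3 ((hR_out z z' h huT' hcT).2 h')⟩, (hF_out z z' h).1 e4⟩)
  have hI2 := card_and_mul_card_univ ins
    (fun z => ¬ (openGraph (labelledOpen ends z)).Reachable u s ∧
          (openGraph (labelledOpen ends (clusterFlip ends u fun x => !z x))).Reachable u s)
    (fun z => ((openGraph (labelledOpen ends z)).Reachable a u ∧ ¬ (openGraph (labelledOpen ends z)).Reachable a c) ∧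
          (openGraph (labelledOpen ends (clusterFlip ends a fun x => !z x))).Reachable u c)
    hV_in
    (by
      rintro z z' h ⟨⟨e1, e2⟩, e4⟩
      exact ⟨⟨(hR_out z z' h haT huT').1 e1, fun h' => e2 ((hR_out z z' h haT hcT).2 h')⟩, (hF_out z z' h).1 e4⟩)
  have hI3 := card_and_mul_card_univ ins
    (fun z => (openGraph (labelledOpen ends z)).Reachable u s)
    (fun z => ((openGraph (labelledOpen ends z)).Reachable a c ∧ ¬ (openGraph (labelledOpen ends z)).Reachable a u) ∧
          (openGraph (labelledOpen ends (clusterFlip ends a fun x => !z x))).Reachable u c)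
    (fun z z' h hz => (hR_in z z' h).1 hz)
    (by
      rintro z z' h ⟨⟨e1, e2⟩, e4⟩
      exact ⟨⟨(hR_out z z' h haT hcT).1 e1, fun h' => e2 ((hR_out z z' h haT huT').2 h')⟩, (hF_out z z' h).1 e4⟩)
  have hI4 := card_and_mul_card_univ ins
    (fun z => ¬ (openGraph (labelledOpen ends z)).Reachable u s ∧
          (openGraph (labelledOpen ends (clusterFlip ends u fun x => !z x))).Reachable u s)
    (fun z => ((openGraph (labelledOpen ends z)).Reachable a u ∧ (openGraph (labelledOpen ends z)).Reachable a c) ∧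
          (openGraph (labelledOpen ends (clusterFlip ends a fun x => !z x))).Reachable u c)
    hV_in
    (by
      rintro z z' h ⟨⟨e1, e2⟩, e4⟩
      exact ⟨⟨(hR_out z z' h haT huT').1 e1, (hR_out z z' h haT hcT).1 e2⟩, (hF_out z z' h).1 e4⟩)
  have hI5 := card_and_mul_card_univ ins
    (fun z => ¬ (openGraph (labelledOpen ends z)).Reachable u s)
    (fun z => (openGraph (labelledOpen ends z)).Reachable a c ∧ (openGraph (labelledOpen ends z)).Reachable a u)
    (fun z z' h hz => fun h' => hz ((hR_in z z' h).2 h'))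
    (by
      rintro z z' h ⟨e1, e2⟩
      exact ⟨(hR_out z z' h haT hcT).1 e1, (hR_out z z' h haT huT').1 e2⟩)
  have hI6 := card_and_mul_card_univ ins
    (fun z => (openGraph (labelledOpen ends z)).Reachable u s)
    (fun z => (openGraph (labelledOpen ends z)).Reachable a u ∧ (openGraph (labelledOpen ends z)).Reachable a c)
    (fun z z' h hz => (hR_in z z' h).1 hz)
    (by
      rintro z z' h ⟨e1, e2⟩
      exact ⟨(hR_out z z' h haT huT').1 e1, (hR_out z z' h haT hcT).1 e2⟩)
  beta_reduce at hI1 hI2 hI3 hI4 hI5 hI6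
  -- the identity `bad′ + w′ + w′₂ + j′ = J′` on the far side and the two-point facts on the network side
  have hid := card_joined_eq_card_bad_add_flat_counts ends a u c
  have hVC := card_virtual_le_card_conn ends u s
  have hVD := card_virtual_le_card_disc ends u s
  have hCD := Finset.card_filter_add_card_filter_not (s := (univ : Finset (α → Bool)))
    (fun z : α → Bool => (openGraph (labelledOpen ends z)).Reachable u s)
  set U := (univ : Finset (α → Bool)).card with hU
  set Cn := (univ.filter fun z : α → Bool => (openGraph (labelledOpen ends z)).Reachable u s).card with hCn
  set Dn := (univ.filter fun z : α → Bool => ¬ (openGraph (labelledOpen ends z)).Reachable u s).card with hDn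
  set Vn := (univ.filter fun z : α → Bool => ¬ (openGraph (labelledOpen ends z)).Reachable u s ∧
      (openGraph (labelledOpen ends (clusterFlip ends u fun x => !z x))).Reachable u s).card with hVn
  set B := (univ.filter fun z : α → Bool =>
      (¬ (openGraph (labelledOpen ends z)).Reachable a u ∧ ¬ (openGraph (labelledOpen ends z)).Reachable a c ∧
          ¬ (openGraph (labelledOpen ends z)).Reachable u c) ∧
        (openGraph (labelledOpen ends (clusterFlip ends a fun x => !z x))).Reachable u c).card with hB
  set Wt := (univ.filter fun z : α → Bool =>
      ((openGraph (labelledOpen ends z)).Reachable a u ∧ ¬ (openGraph (labelledOpen ends z)).Reachable a c) ∧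
        (openGraph (labelledOpen ends (clusterFlip ends a fun x => !z x))).Reachable u c).card with hWt
  set W2 := (univ.filter fun z : α → Bool =>
      ((openGraph (labelledOpen ends z)).Reachable a c ∧ ¬ (openGraph (labelledOpen ends z)).Reachable a u) ∧
        (openGraph (labelledOpen ends (clusterFlip ends a fun x => !z x))).Reachable u c).card with hW2
  set Jt := (univ.filter fun z : α → Bool =>
      ((openGraph (labelledOpen ends z)).Reachable a u ∧ (openGraph (labelledOpen ends z)).Reachable a c) ∧
        (openGraph (labelledOpen ends (clusterFlip ends a fun x => !z x))).Reachable u c).card with hJt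
  set Q2 := (univ.filter fun z : α → Bool =>
      (openGraph (labelledOpen ends z)).Reachable a c ∧ ¬ (openGraph (labelledOpen ends z)).Reachable a u).card with hQ2
  set J' := (univ.filter fun z : α → Bool =>
      (openGraph (labelledOpen ends z)).Reachable a u ∧ (openGraph (labelledOpen ends z)).Reachable a c).card with hJ'
  set J'' := (univ.filter fun z : α → Bool =>
      (openGraph (labelledOpen ends z)).Reachable a c ∧ (openGraph (labelledOpen ends z)).Reachable a u).card with hJ''
  have hJJ : J'' = J' := by
    rw [hJ'', hJ']; exact congrArg Finset.card (Finset.filter_congr fun z _ => and_comm)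
  set X1 := (univ.filter fun z : α → Bool => (openGraph (labelledOpen ends z)).Reachable u s ∧
      ((¬ (openGraph (labelledOpen ends z)).Reachable a u ∧ ¬ (openGraph (labelledOpen ends z)).Reachable a c ∧
          ¬ (openGraph (labelledOpen ends z)).Reachable u c) ∧
        (openGraph (labelledOpen ends (clusterFlip ends a fun x => !z x))).Reachable u c)).card with hX1
  set X2 := (univ.filter fun z : α → Bool => (¬ (openGraph (labelledOpen ends z)).Reachable u s ∧
        (openGraph (labelledOpen ends (clusterFlip ends u fun x => !z x))).Reachable u s) ∧
      (((openGraph (labelledOpen ends z)).Reachable a u ∧ ¬ (openGraph (labelledOpen ends z)).Reachable a c) ∧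
        (openGraph (labelledOpen ends (clusterFlip ends a fun x => !z x))).Reachable u c)).card with hX2
  set X3 := (univ.filter fun z : α → Bool => (openGraph (labelledOpen ends z)).Reachable u s ∧
      (((openGraph (labelledOpen ends z)).Reachable a c ∧ ¬ (openGraph (labelledOpen ends z)).Reachable a u) ∧
        (openGraph (labelledOpen ends (clusterFlip ends a fun x => !z x))).Reachable u c)).card with hX3
  set X4 := (univ.filter fun z : α → Bool => (¬ (openGraph (labelledOpen ends z)).Reachable u s ∧
        (openGraph (labelledOpen ends (clusterFlip ends u fun x => !z x))).Reachable u s) ∧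
      (((openGraph (labelledOpen ends z)).Reachable a u ∧ (openGraph (labelledOpen ends z)).Reachable a c) ∧
        (openGraph (labelledOpen ends (clusterFlip ends a fun x => !z x))).Reachable u c)).card with hX4
  set Y1 := (univ.filter fun z : α → Bool => ¬ (openGraph (labelledOpen ends z)).Reachable u s ∧
      ((openGraph (labelledOpen ends z)).Reachable a c ∧ (openGraph (labelledOpen ends z)).Reachable a u)).card with hY1
  set Y2 := (univ.filter fun z : α → Bool => (openGraph (labelledOpen ends z)).Reachable u s ∧
      ((openGraph (labelledOpen ends z)).Reachable a u ∧ (openGraph (labelledOpen ends z)).Reachable a c)).card with hY2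
  have hUpos : 0 < U := Finset.card_pos.mpr Finset.univ_nonempty
  have hUCD : Cn + Dn = U := hCD
  -- the arithmetic: x = B + W2, y = Wt + Jt
  have harith := network_arith_S1Jc (B + W2) (Wt + Jt) Q2 J' Cn Dn Vn h (by rw [hid]; ring) hVC hVD
  have hL : (X1 + X2 + (X3 + X4)) * U = Cn * (B + W2) + Vn * (Wt + Jt) := by
    have : (X1 + X2 + (X3 + X4)) * U = X1 * U + X2 * U + X3 * U + X4 * U := by ring
    rw [this, hI1, hI2, hI3, hI4]; ring
  have hR : (Q2 + Y1) * U * (Y2 * U) = Cn * J' * ((Cn + Dn) * Q2 + Dn * J') := by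
    have : (Q2 + Y1) * U * (Y2 * U) = (Q2 * U + Y1 * U) * (Y2 * U) := by ring
    rw [this, hI5, hI6, hJJ, ← hUCD]; ring
  have key' : (X1 + X2 + (X3 + X4)) ^ 2 * (U * U) ≤ (Q2 + Y1) * Y2 * (U * U) := by
    calc (X1 + X2 + (X3 + X4)) ^ 2 * (U * U) = ((X1 + X2 + (X3 + X4)) * U) ^ 2 := by ring
      _ = (Cn * (B + W2) + Vn * (Wt + Jt)) ^ 2 := by rw [hL]
      _ ≤ Cn * J' * ((Cn + Dn) * Q2 + Dn * J') := harith
      _ = (Q2 + Y1) * U * (Y2 * U) := hR.symm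
      _ = (Q2 + Y1) * Y2 * (U * U) := by ring
  exact Nat.le_of_mul_le_mul_right key' (Nat.mul_pos hUpos hUpos)

end CountsS1Jc

end Summit.CriticalPhenomena.PercolationContinuityZ3.Theorems.ProductFormFibre
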